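import Summits.FinalStateConjecture.FinalStateConjecture.Theses.ConcentrationCannotWait
import Summits.FinalStateConjecture.FinalStateConjecture.Theorems.DrainImpliesDisperse.Negative.DrainImpliesDisperseFalseOfPulsedObserver
import Summits.FinalStateConjecture.FinalStateConjecture.Theorems.CompleteSpacetimesDisperse.Negative.CompleteSpacetimesDisperseFalseOfCompletePulsedObserver
import HarnessLib

/-!
# Crux `RegularCompleteDisperses` (stmt-FinalStateConjecture-17276), negative side:
# a REGULAR development (complete `𝓘⁺`, future causally geodesically complete) carrying a persistently
# pulsed observer

Route `ConcentrationCannotWait`, crux r2 `RegularCompleteDisperses`: for EVERY admissible datum (far field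
controlled to second order only, `h = (1 + 2M/r)δ + o₂(r⁻¹)`, `k = o₁(r⁻²)`) and every maximal vacuum Cauchy
development with complete `𝓘⁺` (sojourn form) that is future causally geodesically complete, an honest `N = 0`
final-state decomposition of order `2`: a flat chart on the whole late half-space whose `C²` deviation from
`η` tends to `0` on ENTIRE late slabs, with `RaysStayInClosure`, `HasExhaustiveCharts`, `IsFutureOriented`.
It is the sister of `NoParkingWithoutHorizon.CompleteSpacetimesDisperse` (stmt-17320) with complete `𝓘⁺`
moved from the conclusion to the hypotheses (route-review glue `CompleteSpacetimesDisperse →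
RegularCompleteDisperses`, 2026-08-16), so the negative lemma of that crux
(`Theorems.CompleteSpacetimesDisperse.Negative`, refuter g26, 2026-08-30, itself transported from
`Theorems.DrainImpliesDisperse.Negative.drainImpliesDisperse_false_of_pulsedObserver`, line lead
`prover-line-stmt-FinalStateConjecture-17283-c4-0`, 2026-08-17) transports once more: the contradiction uses
ONLY the common conclusion (honest `N = 0` slabs reach every persistently visible observer, and a `δ`-pulse
in `C²` at such an event defeats `deviationCk … 2 → 0`), the witness development now being asked to have
complete `𝓘⁺` as well — which the expected witness (the maximal development of a small time-symmetric
far-field ripple datum, dispersing with `C⁰/C¹ → 0` while `3`-D focusing at the centre produces `C²` pulses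
at times `t_n → ∞`) has on paper. The witness is packaged as the construction hypothesis
`RegularCompletePulsedObserverDevelopmentExists` (= `CompletePulsedObserverDevelopmentExists` + complete
`𝓘⁺`; an MGHD-level object, not constructible in the tree today — no maximal development of any non-flat
admissible datum exists in Lean) and we record
`RegularCompletePulsedObserverDevelopmentExists → ¬ RegularCompleteDisperses`: a NEGATIVE LEMMA MODULO `H`,
not a refutation, plus the bookkeeping implication `RegularCompletePulsedObserverDevelopmentExists →
CompletePulsedObserverDevelopmentExists` (one construction discharges both sister lemmas). It is the kernel
form of the statement-health pointer of 2026-08-30 on the item (critic g5 row 170 (iii): "17276 … is refuted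
as typed mod the DrainImpliesDisperse/Negative/* construction hypotheses; surviving shapes = decay-guarded /
CK-guarded") and says that the truth value of the item AS FILED is decided by far-field regularity
bookkeeping: repairs are C′1 = decomposition order `2 ↦ 1` with a generic `C¹ → C²` upgrade moved to the
collapse crux, or C′2 = Christodoulou–Klainerman-class data (`IsStronglyAsymptoticallyFlatCK`), or C′3 = a
`locally scattering` hypothesis (scale-invariant curvature flux through `{r ≤ R}` tends to `0`, the transfer
lens's Luk–Oh dictionary, evidence DICTIONARY.md 2026-08-17).

References: B. O'Neill, *Semi-Riemannian geometry* (1983), Ch. 14, Lemma 14.3, Cor. 14.1, p. 402;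
F. John, *Partial Differential Equations* (4th ed., 1982), Ch. 5 §1 (focusing of spherical waves);
D. Christodoulou, S. Klainerman 1993, (1.0.9). Refuter `refuter-bsd-print-cf2-ref-g27-0`, 2026-08-30.
-/

noncomputable section

-- D-0017: single-problem summit, `Summit.<S>.<S>.…` by design (cf. lakefile `weak.linter.dupNamespace`).
set_option linter.dupNamespace false

open Set Filter Function TopologicalSpace Topology
open scoped Manifold ContDiff Topology

namespace Summit.FinalStateConjecture.FinalStateConjecture.Theorems.RegularCompleteDisperses.Negative

open Literature.Geometry.Lorentzian
open Summit.FinalStateConjecture (HasCompleteNullInfinity exteriorOf RaysStayInClosure HasExhaustiveCharts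
  IsFutureOriented certifiedLate certifiedSlab)
open Summit.FinalStateConjecture.FinalStateConjecture.Theses.ConcentrationCannotWait (RegularCompleteDisperses)
open Summit.FinalStateConjecture.FinalStateConjecture.Theorems.DrainImpliesDisperse.Negative
  (mem_chronologicalFuture_of_timelikeCurve mem_chronologicalPast_of_mem_closure not_mem_causalPast_of_isAchronal
    diff_lateRegion_subset_causalPast_slab_of_N_eq_zero worldline_mem_exteriorOf)
open Summit.FinalStateConjecture.FinalStateConjecture.Theorems.CompleteSpacetimesDisperse.Negative
  (CompletePulsedObserverDevelopmentExists)

/-! ### Regularity side condition -/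

/-- `1 ≤ ∞` in `ℕ∞ω` (regularity side condition of the push-up lemma). [folklore] -/
private lemma one_le_infty : (1 : ℕ∞ω) ≤ ((⊤ : ℕ∞) : ℕ∞ω) := WithTop.coe_le_coe.mpr le_top

/-- **`RegularCompleteDisperses` is false on a future causally geodesically complete maximal development
with complete `𝓘⁺` carrying a persistently pulsed observer** (binder form; the hypotheses are exactly the
fields of `RegularCompletePulsedObserverDevelopmentExists`). Given an admissible datum, a maximal vacuum
Cauchy development `𝒟` which is future causally geodesically complete and has complete future null infinity
(both are HYPOTHESES of the crux, so they are fed to it, not contradicted), a future timelike curve `c` on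
`[0, ∞)` with (R) every `c s`, `s ≥ 0`, on a future-complete normalised null ray from the data at a parameter
`≥ 0`, (V) `∀ a ∈ J⁺(ι X), ∃ s ≥ 0, a ≪ c s`, (W) for every `s₀` a later parameter `s > s₀` at which no local
chart of the flat background through `c s` is `δ`-quiet in `C²`, `0 < δ`, and (A) every entire,
`C²`-asymptotically flat, eventually future-oriented late chart of the flat background into `J⁺(ι X)` has
eventually achronal slabs: then the crux fails. Proof verbatim as
`Theorems.CompleteSpacetimesDisperse.Negative.completeSpacetimesDisperse_false_of_pulsedObserver`
(refuter g26, 2026-08-30) — honest `N = 0` slabs (`RaysStayInClosure` + `HasExhaustiveCharts` +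
eventual achronality) reach the pulse event `c s`, where (W) defeats `deviationCk … 2 → 0`; only the line
extracting the crux's decomposition differs (complete `𝓘⁺` is now an input).
[cite: ONeillSemiRiemannian1983, Ch. 14, Cor. 14.1 (p. 402)] -/
theorem regularCompleteDisperses_false_of_pulsedObserver (X : Type) [TopologicalSpace X]
    [ChartedSpace E3 X] [IsManifold (𝓡 3) ∞ X] [T2Space X] [SecondCountableTopology X]
    [ConnectedSpace X] (D : InitialDataSet (𝓡 3) X) (hD : D ∈ admissibleVacuumData X)
    (𝒟 : VacuumCauchyDevelopment D) (hmax : 𝒟.IsMaximal)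
    (hcompl : ∀ [𝒟.metric.HasLeviCivita],
      ¬ 𝒟.metric.IsFutureNullGeodesicallyIncomplete 𝒟.timeOrientation ∧
        ¬ 𝒟.metric.IsFutureTimelikeGeodesicallyIncomplete 𝒟.timeOrientation)
    (hscri : HasCompleteNullInfinity 𝒟.toCauchyDevelopment)
    (c : ℝ → 𝒟.carrier) (δ : ENNReal) (hδ : 0 < δ)
    (hc : 𝒟.metric.IsFutureTimelikeCurveOn 𝒟.timeOrientation c (Ici 0))
    (hray : ∀ [𝒟.metric.HasLeviCivita], ∀ s : ℝ, 0 ≤ s →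
      ∃ (p : X) (γ : ℝ → 𝒟.carrier) (dom : Set ℝ) (t : ℝ),
        𝒟.metric.IsNormalisedNullRayFrom 𝒟.timeOrientation 𝒟.embed 𝒟.normal p γ dom ∧
          ¬ BddAbove dom ∧ t ∈ dom ∧ 0 ≤ t ∧ γ t = c s)
    (hvis : ∀ a ∈ 𝒟.metric.causalFuture 𝒟.timeOrientation (range 𝒟.embed),
      ∃ s : ℝ, 0 ≤ s ∧ c s ∈ 𝒟.metric.chronologicalFuture 𝒟.timeOrientation {a})
    (hwild : ∀ s₀ : ℝ, ∃ s : ℝ, s₀ < s ∧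
      ∀ (U : Opens E4) (Φ : (Minkowski.backgroundOn U).domain → 𝒟.carrier)
        (V : Set (Minkowski.backgroundOn U).domain) (x : (Minkowski.backgroundOn U).domain),
        IsOpen V → x ∈ V → ContMDiff 𝓘(ℝ, E4) (𝓡 4) ∞ Φ → IsOpenEmbedding (V.restrict Φ) →
        Φ x = c s →
        δ ≤ supCkENorm {(x : E4)} 2 (𝒟.toSpacetime.deviationExtend (Minkowski.backgroundOn U) Φ))
    (hach : ∀ (U : Opens E4) (τ₀ : ℝ) (Φ : (Minkowski.backgroundOn U).domain → 𝒟.carrier),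
      Minkowski.lateRegion τ₀ ⊆ (U : Set E4) →
      𝒟.toSpacetime.IsLateChart (Minkowski.backgroundOn U)
        (𝒟.metric.causalFuture 𝒟.timeOrientation (range 𝒟.embed)) τ₀ Φ →
      Tendsto (fun τ ↦ 𝒟.toSpacetime.deviationCk (Minkowski.backgroundOn U) Φ 2 τ) atTop (𝓝 0) →
      (∀ᶠ τ in atTop, ∀ x ∈ (Minkowski.backgroundOn U).timeSlab τ,
        𝒟.timeOrientation.IsFutureDirected (mfderiv 𝓘(ℝ, E4) (𝓡 4) Φ x (E4.basisVector 0))) →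
      ∀ᶠ τ in atTop, 𝒟.metric.IsAchronal 𝒟.timeOrientation
        (Φ '' (Minkowski.backgroundOn U).timeSlab τ)) :
    ¬ RegularCompleteDisperses := by
  intro hS
  obtain ⟨O, d, hN, hO, hrays, hexh, hfut⟩ := hS X D hD 𝒟 hmax hscri hcompl
  have hlate : 𝒟.toSpacetime.IsLateChart (Minkowski.backgroundOn d.flatDomain) O d.τ₀ d.flatChart :=
    d.isLateChart_flat
  have hOJ : O ⊆ 𝒟.metric.causalFuture 𝒟.timeOrientation (range 𝒟.embed) := by
    rw [hO]
    exact inter_subset_left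
  -- (A): the flat chart's slabs are eventually achronal
  have hA : ∀ᶠ τ in atTop, 𝒟.metric.IsAchronal 𝒟.timeOrientation
      (d.flatChart '' (Minkowski.backgroundOn d.flatDomain).timeSlab τ) :=
    hach d.flatDomain d.τ₀ d.flatChart (d.lateRegion_subset_flatDomain_of_N_eq_zero hN)
      ⟨hlate.contMDiff, hlate.isOpenEmbedding, hlate.image_subset.trans hOJ⟩
      d.tendsto_deviationCk_flat hfut.2.2
  -- eventually the `C²` deviation on entire flat slabs is `< δ`
  have hdev : ∀ᶠ τ in atTop,
      𝒟.toSpacetime.deviationCk (Minkowski.backgroundOn d.flatDomain) d.flatChart 2 τ < δ :=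
    (tendsto_order.1 d.tendsto_deviationCk_flat).2 δ hδ
  obtain ⟨T, hT⟩ := eventually_atTop.1 (hA.and hdev)
  -- a late chart time `τ₁ > τ₀`, `τ₁ ≥ T`
  obtain ⟨τ₁, hτ₁T, hτ₁0⟩ : ∃ τ₁ : ℝ, T ≤ τ₁ ∧ d.τ₀ < τ₁ :=
    ⟨max T (d.τ₀ + 1), le_max_left _ _, (lt_add_one _).trans_le (le_max_right _ _)⟩
  have hachr := (hT τ₁ hτ₁T).1
  -- the slab point `a₀ = Ψ (τ₁, 0, 0, 0)`
  have hz0 : (τ₁ • E4.basisVector 0 : E4) 0 = τ₁ := by simp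
  have hzU : (τ₁ • E4.basisVector 0 : E4) ∈ (d.flatDomain : Set E4) :=
    d.lateRegion_subset_flatDomain_of_N_eq_zero hN
      (show d.τ₀ < (τ₁ • E4.basisVector 0 : E4) 0 by rw [hz0]; exact hτ₁0)
  let x₀ : (Minkowski.backgroundOn d.flatDomain).domain := ⟨τ₁ • E4.basisVector 0, hzU⟩
  have hx₀slab : x₀ ∈ (Minkowski.backgroundOn d.flatDomain).timeSlab τ₁ :=
    show (τ₁ • E4.basisVector 0 : E4) 0 = τ₁ from hz0
  have hx₀late : x₀ ∈ (Minkowski.backgroundOn d.flatDomain).lateRegion d.τ₀ :=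
    show d.τ₀ < (τ₁ • E4.basisVector 0 : E4) 0 by rw [hz0]; exact hτ₁0
  have ha₀O : d.flatChart x₀ ∈ O := hlate.image_subset (mem_image_of_mem d.flatChart hx₀late)
  -- the observer sees `a₀`; a later pulse event `c s ≫ a₀`
  obtain ⟨s₀, hs₀, hvis₀⟩ := hvis (d.flatChart x₀) (hOJ ha₀O)
  obtain ⟨s, hs₀s, hws⟩ := hwild s₀
  have hs : 0 ≤ s := hs₀.trans hs₀s.le
  have hcs : c s ∈ 𝒟.metric.chronologicalFuture 𝒟.timeOrientation {d.flatChart x₀} :=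
    LorentzianMetric.mem_chronologicalFuture_trans hvis₀
      (mem_chronologicalFuture_of_timelikeCurve hs₀s
        (hc.mono fun r hr ↦ mem_Ici.mpr (hs₀.trans hr.1)))
  -- `c s ∈ O`, hence in the flat chart's late region after `τ₁`
  have hcsO : c s ∈ O := worldline_mem_exteriorOf 𝒟.toCauchyDevelopment hO hrays hc hray hs
  have hcsL : c s ∈ d.flatChart '' (Minkowski.backgroundOn d.flatDomain).lateRegion τ₁ := by
    by_contra hnot
    exact not_mem_causalPast_of_isAchronal one_le_infty hachr (mem_image_of_mem d.flatChart hx₀slab)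
      hcs (diff_lateRegion_subset_causalPast_slab_of_N_eq_zero d hN hexh hτ₁0 ⟨hcsO, hnot⟩)
  obtain ⟨x, hxlate, hxcs⟩ := hcsL
  have hxlate' : τ₁ < (x : E4) 0 := hxlate
  -- (W) at `c s = Ψ x` against `deviationCk … 2 (x⁰) < δ`
  have hopen : IsOpen ((Minkowski.backgroundOn d.flatDomain).lateRegion d.τ₀) := by
    have hc0 : Continuous fun y : E4 ↦ y 0 := PiLp.continuous_apply 2 _ 0
    exact isOpen_lt continuous_const (hc0.comp continuous_subtype_val)
  have hxlate0 : x ∈ (Minkowski.backgroundOn d.flatDomain).lateRegion d.τ₀ :=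
    (Minkowski.backgroundOn d.flatDomain).lateRegion_mono hτ₁0.le hxlate
  have hle := hws d.flatDomain d.flatChart ((Minkowski.backgroundOn d.flatDomain).lateRegion d.τ₀) x
    hopen hxlate0 hlate.contMDiff hlate.isOpenEmbedding hxcs
  have hxslab : (x : E4) ∈
      Subtype.val '' (Minkowski.backgroundOn d.flatDomain).timeSlab ((x : E4) 0) := ⟨x, rfl, rfl⟩
  have hmono : supCkENorm {(x : E4)} 2
      (𝒟.toSpacetime.deviationExtend (Minkowski.backgroundOn d.flatDomain) d.flatChart) ≤
      𝒟.toSpacetime.deviationCk (Minkowski.backgroundOn d.flatDomain) d.flatChart 2 ((x : E4) 0) :=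
    supCkENorm_mono (singleton_subset_iff.mpr hxslab) 2 _
  have hlt : 𝒟.toSpacetime.deviationCk (Minkowski.backgroundOn d.flatDomain) d.flatChart 2
      ((x : E4) 0) < δ :=
    (hT ((x : E4) 0) (hτ₁T.trans hxlate'.le)).2
  exact absurd (hle.trans hmono) (not_le.mpr hlt)


/-- **Construction hypothesis `H` (a REGULAR development — complete `𝓘⁺`, future causally geodesically
complete — with a persistently pulsed observer).** Some admissible datum has a maximal vacuum Cauchy
development `𝒟` which is future causally geodesically complete (for the Levi-Civita connection: no future
null and no future timelike geodesic incompleteness) AND has complete future null infinity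
(`HasCompleteNullInfinity`, the sojourn form of the Statement), together with a curve `c : ℝ → M` and a floor
`0 < δ ≤ ∞`, such that: (T) `c` is a future timelike curve on `[0, ∞)`; (R) every event `c s`, `s ≥ 0`, lies
on a future-complete normalised null ray from the data hypersurface at an affine parameter `≥ 0`; (V) every
event of `J⁺(ι X)` is chronologically seen by the observer; (W) for every `s₀` there is `s > s₀` such that no
local chart of the flat background through `c s` is `δ`-quiet in `C²` there; (A) every late chart of the
flat background over an open `U ⊇ {x⁰ > τ₀}` into `J⁺(ι X)` whose `C²` deviation on the entire slabs tends to
`0` and whose push-forward of `∂₀` is eventually future-directed on the slabs has eventually ACHRONAL slabs.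
= `Theorems.CompleteSpacetimesDisperse.Negative.CompletePulsedObserverDevelopmentExists` with the one extra
field complete `𝓘⁺`. Expected on paper for the maximal development of a time-symmetric admissible small
far-field ripple datum (conformal method from `δ + ε r⁻¹⁰ sin(r⁴) w₀`, cf.
`Theorems.DrainImpliesDisperse.Negative.PulsedObserverDevelopmentExists` and the sister item's evidence
`SuspectFalse17320.md`): the `o₂(r⁻¹)` class does not control `∂³h`, `3`-D focusing at the centre produces
the `C²` pulses (W) at times `t_n → ∞` while `C⁰/C¹` decay, and outgoing null geodesics of a dispersing
small-data spacetime have unbounded area radius (complete `𝓘⁺` in the sojourn form); completeness and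
complete `𝓘⁺` of that development are the small-data expectation but NOT a theorem at this far-field
regularity (the Christodoulou–Klainerman / Lindblad–Rodnianski / Bieri classes control more derivatives),
which is why this is a construction hypothesis `H` of a negative lemma and not a published fact (no citation
tag); NOT constructible in the tree today (no maximal development of any non-flat admissible datum). -/
def RegularCompletePulsedObserverDevelopmentExists : Prop :=
  ∃ (X : Type) (_ : TopologicalSpace X) (_ : ChartedSpace E3 X) (_ : IsManifold (𝓡 3) ∞ X)
    (_ : T2Space X) (_ : SecondCountableTopology X) (_ : ConnectedSpace X)
    (D : InitialDataSet (𝓡 3) X) (_ : D ∈ admissibleVacuumData X) (𝒟 : VacuumCauchyDevelopment D)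
    (_ : 𝒟.IsMaximal)
    (_ : ∀ [𝒟.metric.HasLeviCivita],
      ¬ 𝒟.metric.IsFutureNullGeodesicallyIncomplete 𝒟.timeOrientation ∧
        ¬ 𝒟.metric.IsFutureTimelikeGeodesicallyIncomplete 𝒟.timeOrientation)
    (_ : HasCompleteNullInfinity 𝒟.toCauchyDevelopment)
    (c : ℝ → 𝒟.carrier) (δ : ENNReal),
    0 < δ ∧
    𝒟.metric.IsFutureTimelikeCurveOn 𝒟.timeOrientation c (Ici 0) ∧
    (∀ [𝒟.metric.HasLeviCivita], ∀ s : ℝ, 0 ≤ s →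
      ∃ (p : X) (γ : ℝ → 𝒟.carrier) (dom : Set ℝ) (t : ℝ),
        𝒟.metric.IsNormalisedNullRayFrom 𝒟.timeOrientation 𝒟.embed 𝒟.normal p γ dom ∧
          ¬ BddAbove dom ∧ t ∈ dom ∧ 0 ≤ t ∧ γ t = c s) ∧
    (∀ a ∈ 𝒟.metric.causalFuture 𝒟.timeOrientation (range 𝒟.embed),
      ∃ s : ℝ, 0 ≤ s ∧ c s ∈ 𝒟.metric.chronologicalFuture 𝒟.timeOrientation {a}) ∧
    (∀ s₀ : ℝ, ∃ s : ℝ, s₀ < s ∧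
      ∀ (U : Opens E4) (Φ : (Minkowski.backgroundOn U).domain → 𝒟.carrier)
        (V : Set (Minkowski.backgroundOn U).domain) (x : (Minkowski.backgroundOn U).domain),
        IsOpen V → x ∈ V → ContMDiff 𝓘(ℝ, E4) (𝓡 4) ∞ Φ → IsOpenEmbedding (V.restrict Φ) →
        Φ x = c s →
        δ ≤ supCkENorm {(x : E4)} 2 (𝒟.toSpacetime.deviationExtend (Minkowski.backgroundOn U) Φ)) ∧
    (∀ (U : Opens E4) (τ₀ : ℝ) (Φ : (Minkowski.backgroundOn U).domain → 𝒟.carrier),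
      Minkowski.lateRegion τ₀ ⊆ (U : Set E4) →
      𝒟.toSpacetime.IsLateChart (Minkowski.backgroundOn U)
        (𝒟.metric.causalFuture 𝒟.timeOrientation (range 𝒟.embed)) τ₀ Φ →
      Tendsto (fun τ ↦ 𝒟.toSpacetime.deviationCk (Minkowski.backgroundOn U) Φ 2 τ) atTop (𝓝 0) →
      (∀ᶠ τ in atTop, ∀ x ∈ (Minkowski.backgroundOn U).timeSlab τ,
        𝒟.timeOrientation.IsFutureDirected (mfderiv 𝓘(ℝ, E4) (𝓡 4) Φ x (E4.basisVector 0))) →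
      ∀ᶠ τ in atTop, 𝒟.metric.IsAchronal 𝒟.timeOrientation
        (Φ '' (Minkowski.backgroundOn U).timeSlab τ))

/-- Bookkeeping: the regular construction hypothesis contains the sister crux's one (drop the complete-`𝓘⁺`
field), so ONE construction discharges both negative lemmas (`¬ RegularCompleteDisperses` here and
`¬ NoParkingWithoutHorizon.CompleteSpacetimesDisperse` in `Theorems.CompleteSpacetimesDisperse.Negative`).
[folklore] -/
theorem completePulsedObserverDevelopmentExists_of_regular
    (H : RegularCompletePulsedObserverDevelopmentExists) : CompletePulsedObserverDevelopmentExists := by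
  obtain ⟨X, i₁, i₂, i₃, i₄, i₅, i₆, D, hD, 𝒟, hmax, hcompl, -, c, δ, hrest⟩ := H
  exact ⟨X, i₁, i₂, i₃, i₄, i₅, i₆, D, hD, 𝒟, hmax, hcompl, c, δ, hrest⟩

/-- **Negative lemma modulo `RegularCompletePulsedObserverDevelopmentExists`**: one regular (complete `𝓘⁺`,
future causally geodesically complete) maximal development of one admissible datum carrying a persistently
pulsed observer falsifies `RegularCompleteDisperses` as filed (its conclusion needs the `C²` deviation of the
flat chart to tend to `0` on ENTIRE late slabs, which by honesty — `RaysStayInClosure`, `HasExhaustiveCharts`,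
`IsFutureOriented` — pass through the pulse events). Not a refutation: `H` is not constructible here.
[folklore] -/
theorem RegularCompleteDisperses_false_of_regularCompletePulsedObserverDevelopmentExists
    (H : RegularCompletePulsedObserverDevelopmentExists) : ¬ RegularCompleteDisperses := by
  obtain ⟨X, _, _, _, _, _, _, D, hD, 𝒟, hmax, hcompl, hscri, c, δ, hδ, hc, hray, hvis, hwild, hach⟩ := H
  exact regularCompleteDisperses_false_of_pulsedObserver X D hD 𝒟 hmax hcompl hscri c δ hδ hc hray hvis
    hwild hach

end Summit.FinalStateConjecture.FinalStateConjecture.Theorems.RegularCompleteDisperses.Negative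

end
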